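import Summits.SmoothPoincare4.SmoothPoincare4.Theses.WeylBudget
import Summits.SmoothPoincare4.SmoothPoincare4.Theorems.WeylBudgetCorkRegluingBudgetStubInvolutiveCorkPresentation
import Summits.SmoothPoincare4.SmoothPoincare4.Theorems.WeylBudgetCorkRegluingBudgetStubIsometricRegluing
import Summits.SmoothPoincare4.SmoothPoincare4.Theorems.WeylBudgetCorkRegluingBudgetSymmetricGerm
import Summits.SmoothPoincare4.SmoothPoincare4.Theorems.WeylBudgetCorkRegluingBudgetBridgeTransportGerm
import Summits.SmoothPoincare4.SmoothPoincare4.Theorems.WeylBudgetCorkRegluingBudgetCollarGluingIsometric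
import Summits.SmoothPoincare4.SmoothPoincare4.Theorems.WeylBudgetCorkRegluingBudgetWeylAdditivity
import Literature.Topology.FourManifolds.CorkPresentationHomotopySphere

/-!
# Crux `CorkRegluingBudget` (stmt-SmoothPoincare4-10831, route WeylBudget, rank 2) — birth skeleton `Lines/birth.lean`

RESHAPE 1 (lead prover-line-stmt-SmoothPoincare4-10831-0, 2026-08-17, cycle 1, after wave 1):
* Stub B2 `stub_isometricRegluing` LANDED verbatim (p148994,
  `Summit.SmoothPoincare4.SmoothPoincare4.Theorems.CorkRegluingBudget.stub_isometricRegluing`, with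
  helpers p147256 `…IsometricRegluingTransport`, p147585 `…IsometricRegluingGlue`) — its local copy is
  removed and the composition calls the landed theorem.
* Stub A `stub_involutiveCorkPresentation` is PROVED MODULO TWO NAMED LITERATURE FACTS (p148873,
  `…Theorems.CorkRegluingBudget.stub_involutiveCorkPresentation_of_facts :
  isHCobordant_sphere_of_homotopySphere_four → involutiveCorkDecomposition → Stub A`; the involutive
  cork theorem was vendored as `Literature.Topology.FourManifolds.involutiveCorkDecomposition`,
  p147235, Kirby 1996 Theorem + Addendum (D) / Akbulut–Yasui 2008 Thm 1.1).  Accordingly Stub A is now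
  a proved theorem of this file and the two facts are the registered stubs `stub_thetaFourVanishes`
  (`Θ₄ = 0`, Kervaire–Milnor 1963) and `stub_involutiveCorkTheorem` (cork theorem with involution) —
  both published theorems without a `_holds` in the tree (XL each: 5-dimensional h-cobordism /
  cork theorem), i.e. the line is CLOSED MODULO {Θ₄ = 0, involutive cork theorem, B1}.
* Stub B1 `stub_symmetricWeylLightMetric` unchanged (open-problem grade; held by the lead).

RESHAPE 2 (same lead, 2026-08-17, cycle 1, after wave 2): the CURVATURE-FREE half of B1 LANDED
(p151848, `…Theorems.CorkRegluingBudget.symmetricGerm_of_involution`: for ANY presentation of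
`S⁴ = C ∪_φ W` and ANY involution `τ` of `∂C` there are a Riemannian `g₁` on `S⁴`, an open
`U ⊇ seam` and a smooth involution `Φ` of `U` — the seam-tube conjugate of `τ × id` — which is a
`g₁`-isometry on `U`, preserves the sides and restricts to `τ`; plus the B1 special cases p149906).
Accordingly B1 is now DERIVED from that theorem and ONE registered open stub
`stub_weylLightPscWithSymmetricGerm` (B1b, the honest analytic residue of the crux): given such a
symmetric germ `(g₁, U, Φ)`, produce a Riemannian `g` on `S⁴` with Levi-Civita connection,
`scal_g > 0`, `g.weylEnergy < 32π²`, for which `Φ` is still an isometry on a smaller open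
`U' ⊆ U` containing the seam.  Open stubs after RESHAPE 2: `stub_thetaFourVanishes` (named fact),
`stub_involutiveCorkTheorem` (named fact), `stub_weylLightPscWithSymmetricGerm` (B1b, open-problem
grade).

RESHAPE 3 (continuation lead c2, 2026-08-17, cycle 2): B1b is SPC4-hard AS FILED (kernel-checked
certificate `Lines/registered_hardness.lean`: B1b + Θ₄=0 + involutive cork theorem + CGY Thm A ⟹
`SmoothPoincare4`) and is TWO-SIDED (a τ-symmetric PSC germ needs control of the collar from both
pieces at once).  The lead's decoupling theorem (`Lines/registered-lead-c2-analysis.md` §3,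
rigorous modulo Bär–Hanke Thm 27, which the tree holds as the named fact
`Literature.Geometry.Riemannian.BarHanke2023_thm27_umbilicNormalForm`) splits it: a warped bridge
`dt² + ψ(t) ĥ` over a τ-invariant `ĥ` with `ψ` concave across the seam is automatically PSC
(`scal = (scal_ĥ − 3ψ'')/ψ`) and carries `id × τ` as an isometry, and its Weyl density is that of
the product `ℝ × (Y, ĥ)` per unit conformal length (conformal invariance of `|W|² dV`), so the
ONE-SIDED data suffice.  Accordingly B1 is now DERIVED from two registered stubs:
`stub_symmetricWarpedFillIns` (F^W — OPEN, one-sided: PSC fill-ins `g_C` of the cork and `g_W` of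
the exterior which are exactly warped-umbilic `ε² ds² + (1 − 2μ εs − K ε² s²) ĥ` in collars over a
COMMON τ-invariant boundary form `ĥ`, mean-convex on balance `μ_C + μ_W > 0`, with
`𝒲(g_C) + 𝒲(g_W) < 32π²`; the classical Bartnik fill-in problem with prescribed symmetric boundary
metric, cf. Shi–Wang–Wei–Zhu 2021 θ-invariant, Sweeney 2026 Prop. 1.2 =
`Sweeney2026_pscMeanConvex`, `ShiWangWei2022_boundaryMetric_extends_psc`) and `stub_warpedBridge`
(PROVABLE, XL: glue the two pieces along their collars, mollify the concave kink of the combined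
profile `ψ` (`ψ'(0−) = 2μ_C > −2μ_W = ψ'(0+)`), read PSC off the generalized-cylinder formula
(`GeneralizedCylinderScalarCurvature.lean`), the Weyl budget off conformal invariance
(`weylEnergy_conformal_sq_four`) and piecewise additivity (`BudgetTransfer*`), and transport to the
given presentation class by uniqueness of gluings as in the landed B2).  B1b
(`stub_weylLightPscWithSymmetricGerm`, RESHAPE 2) remains a documented ALTERNATIVE sufficient stub
(any proof of it closes B1 through the landed B1a, see RESHAPE 2 in the history of this file and
`Lines/registered_hardness.lean`); its linearisable case is landed (p157539,
`weylLightPscWithSymmetricGerm_of_conjugateRound`).  Open stubs after RESHAPE 3: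
`stub_thetaFourVanishes` (named fact), `stub_involutiveCorkTheorem` (named fact),
`stub_symmetricWarpedFillIns` (open, one-sided), `stub_warpedBridge` (provable, XL).

RESHAPE 4 (lead c2, 2026-08-17, cycle 2, later): the sibling crux `CorkRegluablePsc` (item
stmt-SmoothPoincare4-3206) has LANDED the τ-equivariant collar gluing
(`Theorems.stub_collarGluing`, file `WeylBudgetCorkRegluablePscStubCollarGluing.lean`, with the
Literature bricks `WarpedSeamMetric`, `ThreePieceGluedMetric`, `CollarGluingPieces`): two PSC
metrics in umbilic `C₀`-normal form BACK TO BACK (`μ_W ∘ φ = −μ_C`, smooth seam, no kink) over a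
common τ-invariant boundary form glue to a PSC metric with an isometric involution `τ × id`
near the seam.  So the bridge of RESHAPE 3 collapses to bookkeeping and is replaced by two
PROVABLE stubs — `stub_collarGluingIsometric` (= `stub_collarGluing` + the isometry of the piece
embeddings, a re-run of that proof) and `stub_weylAdditivity` (`𝒲(g) ≤ 𝒲(g_C) + 𝒲(g_W)` for an
isometric two-piece gluing, the `budgetTransfer_proof` calculation) — composed in THIS file with
the landed transport-with-germ `bridge_transportGerm` (p158585); Stub F^W is restated in the
same back-to-back vocabulary (`stub_symmetricWarpedFillIns`, RESHAPE 4 form; it is crux 3206's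
open `stub_simultaneousBHData` after Bär–Hanke normalisation, plus the Weyl budget).  Landed
sub-goals of RESHAPE 3's bridge, kept as bricks: `bridge_transportGerm` p158585, `bridge_profile`
p160044 (mollified concave profile — needed only for kinked seams `μ_C + μ_W > 0`),
`bridge_warpedTube_metric` p160629, `bridge_warpedTube_scalarCurvature` p161551
(`ψ·scal = scal_ĥ − 3ψ''`), `bridge_warpedTube_weylWeight` p162210 (`ψ²|W|²` profile-independent).
Open stubs after RESHAPE 4: `stub_thetaFourVanishes`, `stub_involutiveCorkTheorem` (named facts),
`stub_symmetricWarpedFillIns` (open, one-sided), `stub_collarGluingIsometric` (provable,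
mechanical), `stub_weylAdditivity` (provable, L).

RESHAPE 5 (lead c2, 2026-08-17, end of cycle 2): `stub_collarGluingIsometric` LANDED (p164488, helpers p164154,
p164155) and `stub_weylAdditivity` LANDED (p165130); their local copies are removed and B1 calls the
landed theorems.  THE LINE IS NOW CLOSED MODULO {`stub_thetaFourVanishes` (Θ₄ = 0, named fact),
`stub_involutiveCorkTheorem` (involutive cork theorem, named fact), `stub_symmetricWarpedFillIns`
(F^W: the ONE-SIDED open fill-in problem)} — the whole geometric mechanism of the route
(symmetric Bär–Hanke fill-ins ⟹ τ-equivariant isometric collar gluing ⟹ Weyl-light PSC metric on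
S⁴ with a τ-symmetric germ ⟹ isometric regluing into Σ ⟹ budget transfer) is kernel-checked.

RESHAPE 6 (continuation lead c3, 2026-08-17, cycle 3): the registered F^W of RESHAPE 4/5 was
OVER-GENERAL — it quantified over EVERY smooth splitting `S⁴ = C ∪_φ W` with an involution `τ` of
`∂C`, without the hypothesis `ContractibleSpace C` that Stub B1 (its only consumer) carries.  In
that generality it is FALSE modulo Chang–Gursky–Yang's Theorem A: its data for `(C, W, φ, τ)` are
verbatim back-to-back data for the TWISTED gluing `φ ∘ τ` (`τ^* h = h`, `μ_C ∘ τ = μ_C`), so the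
landed `stub_collarGluingIsometric` + `stub_weylAdditivity` put a PSC metric with `∫|W|² < 32π² =
16π²χ` on every involutive regluing `X_τ = C ∪_{φτ} W` of the 4-sphere (kernel-checked in
hypothesis form, `Lines/registered_overgeneral.lean`); for the unknotted `T³ = ∂(T² × D²) ⊂ S⁴` and
`τ ∈ GL₃ℤ` the swap of the meridian with a torus direction, `H₁(X_τ; ℤ) ≅ ℤ` (Mayer–Vietoris),
while CGY Thm A (positive Yamabe class, `∫|W|² < 16π²χ`) forces `X_τ ≅ S⁴` or `ℝP⁴` — see
`Lines/registered-lead-c3-analysis.md` §1.  Accordingly F^W now carries `[ContractibleSpace C]`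
(then `∂C` is a connected homology sphere, `X_τ` is a homotopy sphere, and the witness evaporates:
c1 analysis §4); the composition is unchanged (B1 already had the instance in scope).  Open stubs
after RESHAPE 6: `stub_thetaFourVanishes` (fact Θ₄ = 0: leaves `piStable_four_trivial`,
`HomotopySphere.isStablyParallelizable`), `stub_involutiveCorkTheorem` (fact; Milnor's basis
theorem and rung (B) are now DISCHARGED in the tree, the one remaining leaf is (H4)
`Matveyev1996_partOne_and_fact_of_dualSpheres`), `stub_symmetricWarpedFillIns` (F^W, contractible
form: the one-sided research stub).

BC3 skeleton (LENSES-v3 §2, birth certificate) registered by the skeleton registrar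
(planner-skel-stmt-SmoothPoincare4-10831-0, 2026-08-17).  THREE named stubs and the kernel-checked
composition `CorkRegluingBudget_of : CorkRegluingBudget` invoking Stub A, Stub B1, Stub B2 BY NAME (so that
`#h21_check_skeleton` attributes every `sorry` to a declared stub; the hypothesis form
`Stub A → Stub B1 → Stub B2 → CorkRegluingBudget` with the statements as binders is the registrar's evidence file
`birth_hyps_form.lean`, axioms propext / Classical.choice / Quot.sound).

IDEA (the route's own line, card weyl-budget-cork-regluing, made into typed lemmas): the crux asks,
for every homotopy 4-sphere `Σ`, for a cork-twist presentation of `Σ` over `S⁴` together with a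
Weyl-light PSC metric `g` on `S⁴` and a metric `γ` on `Σ` inducing the same piece metrics
(isometric regluing).  The line separates
* the TOPOLOGY — Stub A `stub_involutiveCorkPresentation`: `Σ` is an involutive cork twist of `S⁴`
  (Kirby 1996 Corollary = cork theorem + Matveyev's Addendum (D) + `Θ₄ = 0`);
* the GEOMETRY ON THE STANDARD SPHERE — Stub B1 `stub_symmetricWeylLightMetric` (load-bearing):
  for every involutive cork splitting of `S⁴` a PSC metric with `∫|W|² < 32π²` whose germ along the
  cork boundary is τ-symmetric, i.e. `τ` extends to a side-preserving local isometry `Φ`;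
* the REGLUING — Stub B2 `stub_isometricRegluing`: such a local isometry realises the twisted
  gluing isometrically inside `Σ` itself (gluing of Riemannian pieces along an isometry of collar
  neighbourhoods + uniqueness of boundary gluings; no curvature).
Why three and not two: "topology + (∀ presentation ∃ regluable metric)" would be FALSE as a middle
stub — for a fixed pair of presentations a collar kink, or a twist `τ` preserving no metric on
`∂C`, obstructs every `γ`; the existential re-choice of the presentation (B1) and of the `Σ`-side
embeddings (B2) is exactly where the line's freedom lives, and the involution is what makes a
symmetric germ available at all.

HARDEST STUB: B1 (open; SPC4-strength modulo A, B2, the proved `budgetTransfer_proof` and CGY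
Thm A, but not a restatement of the crux or of SPC4 — it lives on the standard sphere and asks for
symmetry).  B2 is folklore-but-long (L); A is the cork theorem with involution (XL / named facts).

DISPROOF USED: none — `ledger crux ls stmt-SmoothPoincare4-10831` shows no `Disproof.lean`, no
`Negative/` lemma and no dead line for this crux (2026-08-17); `ledger negatives` for the summit
was read by the route's planners (route header: "the negatives index is empty" for this line).

SOURCES: KirbyCorks1996 (arXiv:math/9712231, Corollary p. 1, Addendum (D)), Matveyev1996,
CurtisFreedmanHsiangStong1996, KervaireMilnorAnnals1963 (Θ₄ = 0), ChangGurskyYang2003 (Thm A,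
budget 16π²χ = 32π²), BarHanke2023, GromovLawson1980, LawsonMichelsohn1984
(doi:10.1007/bf01388830), Hirsch1976 §8.2, BrockerJanich1982 §13, ONeill1983 Ch. 3.

BC3 AUDIT (2026-08-17): `lean check --json` rc 0, sorries 3 = stubs 3 (one `declaration uses sorry`
warning per `stub_*`, zero elsewhere), `#print axioms corkRegluingBudget_of_hyps` (hypothesis form) = [propext,
Classical.choice, Quot.sound], `CorkRegluingBudget_of` adds only `sorryAx` through the three stubs; probes `stub → CorkRegluingBudget` and `stub → SmoothPoincare4` by
`first | exact? | simpa | aesop` (and each closer alone, `maxHeartbeats 400000`) FAIL for all three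
stubs, 24/24 (exact?: "could not close the goal"; simpa/aesop: assumption failed / exhaustive
search failed for A, heartbeat timeout at `whnf` for B1, B2 — also at 1.6 M heartbeats after
`intro`); details in `Lines/birth.md` §BC3 audit.
-/

-- the prescribed namespace `Summit.<P>.<Sub>.…` duplicates `SmoothPoincare4` (P = Sub)
set_option linter.dupNamespace false

open scoped Manifold ContDiff Topology

noncomputable section

namespace Summit.SmoothPoincare4.SmoothPoincare4.Cruxes.CorkRegluingBudget.Birth

/-- **Stub A — involutive cork presentation** (`stub_involutiveCorkPresentation`; the
topological input of the line).  Every homotopy 4-sphere `Σ` is an INVOLUTIVE cork twist of the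
standard sphere with compact smooth exterior: `S⁴ = C ∪_φ W` and `Σ = C ∪_{φ ∘ τ} W`
(`IsBoundaryGluing`, i.e. explicit piece embeddings into `S⁴` and into `Σ` itself), with `C`
compact contractible, `W` compact, and the twist `τ ∈ Diff(∂C)` an involution, `τ ∘ τ = id`.
This is Kirby's Corollary to the cork theorem with Addendum (D) (R. Kirby, *Akbulut's corks and
h-cobordisms of smooth simply connected 4-manifolds*, Turkish J. Math. 20 (1996),
arXiv:math/9712231, p. 1: "Any homotopy 4-sphere Σ⁴ can be constructed by cutting out a
contractible 4-manifold A₀ from S⁴ and gluing it back in by an involution of ∂A₀"; Matveyev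
1996, Theorem parts 1–2 + the involution addendum; Curtis–Freedman–Hsiang–Stong 1996) on top of
`Θ₄ = 0` (Kervaire–Milnor 1963).  WITHOUT the involution clause it is exactly the tree's
`Literature.Topology.FourManifolds.HomotopySphere.exists_corkPresentation_of_facts`, proved there
from the two named facts `isHCobordant_sphere_of_homotopySphere_four` and
`Matveyev1996_decomposition`; the involution (Matveyev's Addendum (D)) is not yet vendored and is
what makes Stub B1 plausible (a finite-order twist preserves SOME metric on `∂C`; a generic
diffeomorphism of a 3-manifold preserves none, and then no isometric regluing exists at all —
cf. the route's own remark on the Gluck map).  Size: XL as a Lean proof (cork theorem), S as a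
conditional result on the named facts plus an involutive-cork fact.  Disproof used: none (no
`Disproof.lean` / Negative lemma exists for this crux, `ledger crux ls` 2026-08-17).
[cite: KirbyCorks1996, Corollary p. 1 and Addendum (D)] [cite: Matveyev1996, Theorem]
[cite: CurtisFreedmanHsiangStong1996, Theorem] [cite: KervaireMilnorAnnals1963, table p. 504]

RESHAPE 1: Stub A is now DERIVED (theorem `stub_involutiveCorkPresentation` below, no `sorry` of
its own) from the two named-fact stubs `stub_thetaFourVanishes`, `stub_involutiveCorkTheorem` via
the landed conditional theorem `Theorems.CorkRegluingBudget.stub_involutiveCorkPresentation_of_facts`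
(p148873).

**Stub A′ — `Θ₄ = 0`** (`stub_thetaFourVanishes`; NAMED LITERATURE FACT
`Literature.Topology.FourManifolds.isHCobordant_sphere_of_homotopySphere_four`, ThetaFour.lean):
every homotopy 4-sphere is h-cobordant to `S⁴` (Kervaire–Milnor 1963, table p. 504; no `_holds`
in the tree — XL: surgery / the computation of `Θ₄`).  Registered as a stub so that the line is
closed modulo named facts. [cite: KervaireMilnorAnnals1963, table p. 504 (Θ₄ = 0)] -/
theorem stub_thetaFourVanishes :
    Literature.Topology.FourManifolds.isHCobordant_sphere_of_homotopySphere_four := by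
  sorry

/-- **Stub A″ — the cork theorem with involution** (`stub_involutiveCorkTheorem`; NAMED LITERATURE
FACT `Literature.Topology.FourManifolds.involutiveCorkDecomposition`, vendored by this line, p147235):
h-cobordant simply connected closed smooth 4-manifolds `X₁`, `X₂` are `X₁ = C ∪_φ W`,
`X₂ = C ∪_{φ∘τ} W` with `C` compact contractible, `W` compact and `τ` an INVOLUTION of `∂C`
(Curtis–Freedman–Hsiang–Stong 1996 / Matveyev 1996 cork theorem; involution: Kirby 1996, Theorem +
Addendum (D), arXiv:math/9712231 p. 1 and §5; Akbulut–Yasui 2008, Thm. 1.1).  No `_holds` in the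
tree (XL: the 5-dimensional h-cobordism / cork theorem); registered as a stub so that the line is
closed modulo named facts.  [cite: KirbyCorks1996, Theorem and Addendum (D), p. 1, §5]
[cite: AkbulutYasui2008, Thm. 1.1] [cite: CurtisFreedmanHsiangStong1996, Theorem]
[cite: Matveyev1996, Theorem] -/
theorem stub_involutiveCorkTheorem :
    Literature.Topology.FourManifolds.involutiveCorkDecomposition := by
  sorry

/-- **Stub A — involutive cork presentation**, now PROVED modulo the two named-fact stubs
`stub_thetaFourVanishes` (`Θ₄ = 0`) and `stub_involutiveCorkTheorem` (cork theorem with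
involution) by the landed `stub_involutiveCorkPresentation_of_facts` (p148873): every homotopy
4-sphere `Σ` is `C ∪_{φ∘τ} W` where `S⁴ = C ∪_φ W`, `C` compact contractible, `W` compact,
`τ ∘ τ = id`.  [cite: KirbyCorks1996, Corollary p. 1 and Addendum (D)]
[cite: KervaireMilnorAnnals1963, table p. 504] -/
theorem stub_involutiveCorkPresentation :
    ∀ S : Literature.Topology.FourManifolds.HomotopySphere 4,
      ∃ (C : Type) (_ : TopologicalSpace C) (_ : T2Space C) (_ : SecondCountableTopology C)
        (_ : ChartedSpace (EuclideanHalfSpace 4) C) (_ : IsManifold (𝓡∂ 4) ∞ C)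
        (_ : CompactSpace C) (_ : ContractibleSpace C)
        (bC : Literature.Topology.FourManifolds.BoundaryData (𝓡∂ 4) C (𝓡 3))
        (W : Type) (_ : TopologicalSpace W) (_ : T2Space W) (_ : SecondCountableTopology W)
        (_ : ChartedSpace (EuclideanHalfSpace 4) W) (_ : IsManifold (𝓡∂ 4) ∞ W)
        (_ : CompactSpace W)
        (bW : Literature.Topology.FourManifolds.BoundaryData (𝓡∂ 4) W (𝓡 3))
        (φ : bC.carrier ≃ₘ⟮𝓡 3, 𝓡 3⟯ bW.carrier) (τ : bC.carrier ≃ₘ⟮𝓡 3, 𝓡 3⟯ bC.carrier),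
        (∀ z, τ (τ z) = z) ∧
          Literature.Topology.FourManifolds.IsBoundaryGluing bC bW φ (𝓡 4)
              (Metric.sphere (0 : EuclideanSpace ℝ (Fin 5)) 1) ∧
            Literature.Topology.FourManifolds.IsBoundaryGluing bC bW (τ.trans φ) (𝓡 4) S.carrier :=
  Summit.SmoothPoincare4.SmoothPoincare4.Theorems.CorkRegluingBudget.stub_involutiveCorkPresentation_of_facts
    stub_thetaFourVanishes stub_involutiveCorkTheorem

/-- **Stub F^W — symmetric Bär–Hanke fill-ins under budget** (`stub_symmetricWarpedFillIns`;
RESHAPE 4; the OPEN, ONE-SIDED residue of the crux, stated in the vocabulary of the sibling crux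
`CorkRegluablePsc`'s landed collar gluing `Theorems.stub_collarGluing`).  For every involutive
cork splitting `S⁴ = C ∪_φ W` there are PSC Riemannian metrics `g_C` on the cork and `g_W` on the
exterior (with Levi-Civita connections) which on closed collars `c_C`, `c_W` are the umbilic
`C₀`-normal warped products `ε² ds² + (1 − 2μ_C(z) εs − C₀ ε² s²)·h_C` resp. `… μ_W … h_W`
(`h = ι^* g`; Bär–Hanke 2023, §3 Def. 21 — by the tree's named facts
`BarHanke2023_prop28_meanCurvatureIncrease` / `BarHanke2023_thm27_umbilicNormalForm` every pair
of PSC fill-ins with `ι_C^* g_C = (ι_W φ)^* g_W` τ-invariant and mean curvatures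
`H_C + H_W ∘ φ > 0` can be brought to this form, `μ_C` a smooth τ-invariant function strictly
between `−H_W∘φ/3` and `H_C/3`, cf. the sibling's `stub_symmetricGluingOfBHData_of_facts` — at an
UNCONTROLLED Weyl cost, which is why the normal form is part of the statement), BACK TO BACK
(`μ_W ∘ φ = −μ_C`, so the two collars form one smooth warped tube), with a COMMON τ-INVARIANT
boundary form (`(ι_C τ)^* g_C = ι_C^* g_C = (ι_W φ)^* g_W`), and under budget:
`𝒲(g_C) + 𝒲(g_W) < 32π²`.  Why plausibly true / the freedom: as for RESHAPE 3's F^W (Mazur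
corks and their complements are mean-convex domains of the ROUND sphere, `W ≡ 0`,
Lawson–Michelsohn 1984 / Sweeney 2026 Prop. 1.2 = `Sweeney2026_pscMeanConvex`; every boundary
metric extends to SOME PSC fill-in, `ShiWangWei2022_boundaryMetric_extends_psc`); the content is
τ-invariance of the boundary form + mean-convexity on balance + small Weyl energy at once — the
one-sided Bartnik fill-in problem with symmetric boundary metric (Shi–Wang–Wei–Zhu 2021
θ-invariant), undecided in print for `Y = Σ(2,5,7)`; it is ALSO the open stub
`stub_simultaneousBHData` of crux 3206 plus the budget.  Why it might fail: a θ-invariant /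
Bartnik-mass obstruction for the Akbulut cork (a genuine 'PSC wall', the route's KILL
CRITERION) or a Willmore-type lower bound on `𝒲(g_C) + 𝒲(g_W)`; either kills the LINE, not B1.
With `stub_collarGluingIsometric`, `stub_weylAdditivity` and the landed `bridge_transportGerm`
(p158585) it gives B1.  Size: open.  Disproof used: none exists for this crux (2026-08-17).

RESHAPE 6 (lead c3): the cork is now required to be CONTRACTIBLE (`[ContractibleSpace C]`, the
hypothesis under which B1 consumes this stub).  Without it the statement quantified over every
smooth splitting of `S⁴` along a closed hypersurface and was false modulo CGY Thm A (involutive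
torus surgery on the unknotted `T³ ⊂ S⁴`: `Lines/registered-lead-c3-analysis.md` §1,
`Lines/registered_overgeneral.lean`).  With it, `∂C` is a connected integral homology sphere, the
exterior `W` is a homology ball whose fundamental group is normally generated by `∂W`, and every
involutive regluing `C ∪_{φτ} W` is a homotopy 4-sphere, so no regluing consequence of the stub
goes beyond SPC4 (c1 analysis §4); what remains is the one-sided fill-in problem over a common
τ-invariant boundary form on a cork (c2 analysis §§3–5).
[cite: BarHanke2023, §3 Def. 21, Thm. 27, Prop. 28] [cite: Sweeney2026, Prop. 1.2]
[cite: ShiWangWeiZhu2021, §1 (arXiv:1907.12173)] [cite: LawsonMichelsohn1984, doi:10.1007/bf01388830]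
[cite: ChangGurskyYang2003, Thm A] -/
theorem stub_symmetricWarpedFillIns :
    ∀ (C : Type) [TopologicalSpace C] [T2Space C] [SecondCountableTopology C]
    [ChartedSpace (EuclideanHalfSpace 4) C] [IsManifold (𝓡∂ 4) ∞ C] [CompactSpace C] [ContractibleSpace C]
    (bC : Literature.Topology.FourManifolds.BoundaryData (𝓡∂ 4) C (𝓡 3))
    (W : Type) [TopologicalSpace W] [T2Space W] [SecondCountableTopology W]
    [ChartedSpace (EuclideanHalfSpace 4) W] [IsManifold (𝓡∂ 4) ∞ W] [CompactSpace W]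
    (bW : Literature.Topology.FourManifolds.BoundaryData (𝓡∂ 4) W (𝓡 3))
    (φ : bC.carrier ≃ₘ⟮𝓡 3, 𝓡 3⟯ bW.carrier) (τ : bC.carrier ≃ₘ⟮𝓡 3, 𝓡 3⟯ bC.carrier),
      (∀ z, τ (τ z) = z) →
      Literature.Topology.FourManifolds.IsBoundaryGluing bC bW φ (𝓡 4)
          (Metric.sphere (0 : EuclideanSpace ℝ (Fin 5)) 1) →
      ∃ (gC : Literature.Geometry.Lorentzian.PseudoRiemannianMetric (𝓡∂ 4) ∞ (EuclideanSpace ℝ (Fin 4))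
          (TangentSpace (𝓡∂ 4) : C → Type _)) (_ : gC.HasLeviCivita)
        (gW : Literature.Geometry.Lorentzian.PseudoRiemannianMetric (𝓡∂ 4) ∞ (EuclideanSpace ℝ (Fin 4))
          (TangentSpace (𝓡∂ 4) : W → Type _)) (_ : gW.HasLeviCivita)
        (μC : bC.carrier → ℝ) (μW : bW.carrier → ℝ) (C₀ ε : ℝ) (cC : bC.Collar) (cW : bW.Collar),
        gC.IsRiemannian ∧ (∀ x, 0 < gC.scalarCurvature x) ∧
        gW.IsRiemannian ∧ (∀ x, 0 < gW.scalarCurvature x) ∧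
        0 < ε ∧ ContMDiff (𝓡 3) 𝓘(ℝ, ℝ) ∞ μC ∧ (∀ z, μC (τ z) = μC z) ∧
        (∀ z, μW (φ z) = -μC z) ∧
        (∀ z, Literature.Geometry.Lorentzian.pullbackBilin (I := 𝓡∂ 4) (I' := 𝓡 3) (bC.incl ∘ τ) gC.val z =
          Literature.Geometry.Lorentzian.pullbackBilin (I := 𝓡∂ 4) (I' := 𝓡 3) bC.incl gC.val z) ∧
        (∀ z, Literature.Geometry.Lorentzian.pullbackBilin (I := 𝓡∂ 4) (I' := 𝓡 3) bC.incl gC.val z =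
          Literature.Geometry.Lorentzian.pullbackBilin (I := 𝓡∂ 4) (I' := 𝓡 3) (bW.incl ∘ φ) gW.val z) ∧
        (∀ (p : bC.carrier × Set.Icc (0 : ℝ) 1) (V V' : TangentSpace ((𝓡 3).prod (𝓡∂ 1)) p),
          Literature.Geometry.Lorentzian.pullbackBilin (I := 𝓡∂ 4) (I' := (𝓡 3).prod (𝓡∂ 1)) cC gC.val p V V' =
            ε ^ 2 * ((show EuclideanSpace ℝ (Fin 1) from V.2) 0 *
              (show EuclideanSpace ℝ (Fin 1) from V'.2) 0) +
            (1 - 2 * μC p.1 * (ε * (p.2 : ℝ)) - C₀ * (ε * (p.2 : ℝ)) ^ 2) *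
              Literature.Geometry.Lorentzian.pullbackBilin (I := 𝓡∂ 4) (I' := 𝓡 3) bC.incl gC.val p.1 V.1 V'.1) ∧
        (∀ (q : bW.carrier × Set.Icc (0 : ℝ) 1) (V V' : TangentSpace ((𝓡 3).prod (𝓡∂ 1)) q),
          Literature.Geometry.Lorentzian.pullbackBilin (I := 𝓡∂ 4) (I' := (𝓡 3).prod (𝓡∂ 1)) cW gW.val q V V' =
            ε ^ 2 * ((show EuclideanSpace ℝ (Fin 1) from V.2) 0 *
              (show EuclideanSpace ℝ (Fin 1) from V'.2) 0) +
            (1 - 2 * μW q.1 * (ε * (q.2 : ℝ)) - C₀ * (ε * (q.2 : ℝ)) ^ 2) *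
              Literature.Geometry.Lorentzian.pullbackBilin (I := 𝓡∂ 4) (I' := 𝓡 3) bW.incl gW.val q.1 V.1 V'.1) ∧
        gC.weylEnergy + gW.weylEnergy < ENNReal.ofReal (32 * Real.pi ^ 2) := by
  sorry

/-! **Stub GLUE `stub_collarGluingIsometric`** (RESHAPE 4) — LANDED p164488 as
`Summit.SmoothPoincare4.SmoothPoincare4.Theorems.CorkRegluingBudget.stub_collarGluingIsometric`
(file `Theorems/WeylBudgetCorkRegluingBudgetCollarGluingIsometric.lean`, helpers p164154
`…CollarGluingIsometricDisjoint`, p164155 `…CollarGluingIsometricThreePiece`): the sibling crux's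
τ-equivariant collar gluing with isometric piece embeddings.  **Stub ADD `stub_weylAdditivity`**
(RESHAPE 4) — LANDED p165130 as `…Theorems.CorkRegluingBudget.stub_weylAdditivity`
(file `Theorems/WeylBudgetCorkRegluingBudgetWeylAdditivity.lean`): `𝒲(g) ≤ 𝒲(g_C) + 𝒲(g_W)` for an
isometric two-piece gluing.  Both local sorried copies are removed (RESHAPE 5); the derivation of
B1 below calls the landed theorems. -/

/-- **Stub B1 — a τ-symmetric Weyl-light PSC metric on the standard sphere**
(`stub_symmetricWeylLightMetric`; the LOAD-BEARING stub, the card's `X_cork` made uniform over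
involutive cork splittings).  For every involutive cork splitting of the standard sphere —
abstract pieces `C` (compact contractible) and `W` (compact) with boundary data, `φ : ∂C ≅ ∂W`,
an involution `τ` of `∂C`, and `S⁴ = C ∪_φ W` — there are a presentation `jC, jW` of that
splitting, a Riemannian metric `g` on `S⁴` with Levi-Civita connection, `scal_g > 0` everywhere
and Weyl energy `g.weylEnergy < 32π²` ((0,4)-norm of `WeylEnergy.lean`; `= 8π²` operator norm,
the Chang–Gursky–Yang budget), an open neighbourhood `U` of the seam `Y = jC(∂C)` and a map `Φ`,
smooth and injective on `U`, which is a `g`-ISOMETRY on `U` (`Φ^* g = g` there), preserves the two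
sides `jC(C)`, `jW(W)`, and restricts to the cork involution on the seam:
`Φ (jC (ι z)) = jC (ι (τ z))`.  Informally: the regluable-PSC class of `(S⁴ ⊃ Y, τ)` is non-empty
and its Weyl infimum is under budget.  A Φ-symmetric metric ALWAYS exists (average `g₀ + Φ₀^* g₀`
in a Fermi collar of `Y` for the involution `Φ₀ = τ × id` and cut off); the content is to keep
`scal > 0` through the symmetrisation zone (Gromov–Lawson / Bär–Hanke boundary flexibility; by
Lawson–Michelsohn every cork in `S⁴` is isotopic to a mean-convex domain of the round metric, so
no sign-of-`H` wall arises, route review gen-2) at Weyl cost `< 32π²` minus the bending energy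
already spent (Chern–Simons floor `≤ 6π² < 8π²`).  Why it might fail: a 'PSC wall' for two-sided
τ-symmetric germs along a hyperbolic homology sphere `Y ⊂ S⁴`, or a Willmore-type gap forcing
`∫|W|² ≥ 32π²` on every τ-symmetric PSC metric; either kills the LINE (not the crux).  Modulo
Stubs A, B2, the proved transfer `budgetTransfer_proof` and CGY Thm A it implies SPC4 for
involutive cork twists, i.e. SPC4 — it is NOT a restatement: it speaks of the standard sphere
only and asks for a symmetric metric, which SPC4 does not provide.  Size: open-problem / XL.
Disproof used: none exists for this crux.  [cite: ChangGurskyYang2003, Thm A]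
[cite: BarHanke2023, master theorem] [cite: GromovLawson1980] [cite: LawsonMichelsohn1984,
doi:10.1007/bf01388830] [cite: KirbyCorks1996, Addendum (D)]

RESHAPE 2 (superseded): derived from the landed B1a `symmetricGerm_of_involution` (p151848)
and B1b `stub_weylLightPscWithSymmetricGerm` (kept as an alternative sufficient stub, see the
module docstring).  RESHAPE 3: derived from the one-sided Stub F^W and the bridge `stub_warpedBridge`.
RESHAPE 4/5: now DERIVED from Stub F^W `stub_symmetricWarpedFillIns` (Bär–Hanke normal-form
fill-ins under budget, OPEN) and three LANDED theorems: the isometric collar gluing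
`stub_collarGluingIsometric` (p164488), the additivity `stub_weylAdditivity` (p165130) and the
transport-with-germ `bridge_transportGerm` (p158585). -/
theorem stub_symmetricWeylLightMetric :
    ∀ (C : Type) [TopologicalSpace C] [T2Space C] [SecondCountableTopology C]
      [ChartedSpace (EuclideanHalfSpace 4) C] [IsManifold (𝓡∂ 4) ∞ C] [CompactSpace C] [ContractibleSpace C]
      (bC : Literature.Topology.FourManifolds.BoundaryData (𝓡∂ 4) C (𝓡 3))
      (W : Type) [TopologicalSpace W] [T2Space W] [SecondCountableTopology W]
      [ChartedSpace (EuclideanHalfSpace 4) W] [IsManifold (𝓡∂ 4) ∞ W] [CompactSpace W]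
      (bW : Literature.Topology.FourManifolds.BoundaryData (𝓡∂ 4) W (𝓡 3))
      (φ : bC.carrier ≃ₘ⟮𝓡 3, 𝓡 3⟯ bW.carrier) (τ : bC.carrier ≃ₘ⟮𝓡 3, 𝓡 3⟯ bC.carrier),
      (∀ z, τ (τ z) = z) →
      Literature.Topology.FourManifolds.IsBoundaryGluing bC bW φ (𝓡 4)
          (Metric.sphere (0 : EuclideanSpace ℝ (Fin 5)) 1) →
      ∃ (jC : C → Metric.sphere (0 : EuclideanSpace ℝ (Fin 5)) 1)
        (jW : W → Metric.sphere (0 : EuclideanSpace ℝ (Fin 5)) 1)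
        (g : Literature.Geometry.Lorentzian.PseudoRiemannianMetric (𝓡 4) ∞ (EuclideanSpace ℝ (Fin 4))
          (TangentSpace (𝓡 4) : Metric.sphere (0 : EuclideanSpace ℝ (Fin 5)) 1 → Type _))
        (U : Set (Metric.sphere (0 : EuclideanSpace ℝ (Fin 5)) 1))
        (Φ : Metric.sphere (0 : EuclideanSpace ℝ (Fin 5)) 1 → Metric.sphere (0 : EuclideanSpace ℝ (Fin 5)) 1),
        Manifold.IsSmoothEmbedding (𝓡∂ 4) (𝓡 4) ∞ jC ∧
          Manifold.IsSmoothEmbedding (𝓡∂ 4) (𝓡 4) ∞ jW ∧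
          Set.range jC ∪ Set.range jW = Set.univ ∧
          (∀ a b, jC a = jW b ↔ ∃ z, a = bC.incl z ∧ b = bW.incl (φ z)) ∧
          g.IsRiemannian ∧
          (∃ _ : g.HasLeviCivita, (∀ x, 0 < g.scalarCurvature x) ∧
              g.weylEnergy < ENNReal.ofReal (32 * Real.pi ^ 2)) ∧
          IsOpen U ∧
          (∀ z, jC (bC.incl z) ∈ U) ∧
          ContMDiffOn (𝓡 4) (𝓡 4) ∞ Φ U ∧
          Set.InjOn Φ U ∧
          (∀ x ∈ U, Literature.Geometry.Lorentzian.pullbackBilin (I := 𝓡 4) (I' := 𝓡 4) Φ g.val x = g.val x) ∧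
          (∀ x ∈ U, x ∈ Set.range jC → Φ x ∈ Set.range jC) ∧
          (∀ x ∈ U, x ∈ Set.range jW → Φ x ∈ Set.range jW) ∧
          (∀ z, Φ (jC (bC.incl z)) = jC (bC.incl (τ z))) := by
  intro C _ _ _ _ _ _ _ bC W _ _ _ _ _ _ bW φ τ hτ hS4
  obtain ⟨gC, hLCC, gW, hLCW, μC, μW, C₀, ε, cC, cW, hRC, hSC, hRW, hSW, hε, hμ, hμτ, hμW, hτh,
    hCW, hcC, hcW, hbudget⟩ := stub_symmetricWarpedFillIns C bC W bW φ τ hτ hS4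
  haveI := hLCC
  haveI := hLCW
  obtain ⟨P, tP, t2P, scP, chP, mP, jC, jW, ⟨hjC, hjW, hcov, hseam⟩, g, U, T, hg, ⟨hLC, hscal⟩,
    hU, hYU, hTs, hTU, hTT, hTside, hTτ, hTg, hpC, hpW⟩ :=
    Summit.SmoothPoincare4.SmoothPoincare4.Theorems.CorkRegluingBudget.stub_collarGluingIsometric C bC W
      bW φ τ hτ gC gW μC μW C₀ ε cC cW hRC hSC hRW hSW hε hμ hμτ hμW hτh hCW hcC hcW
  haveI := hLC
  -- the Weyl budget of the glued metric: additivity over the isometric pieces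
  have hseam' : ∀ c w, jC c = jW w → c ∈ (𝓡∂ 4).boundary C := fun c w h ↦ by
    obtain ⟨z, rfl, -⟩ := (hseam c w).1 h
    exact bC.incl_mem_boundary z
  have hWeyl : g.weylEnergy < ENNReal.ofReal (32 * Real.pi ^ 2) :=
    lt_of_le_of_lt (Summit.SmoothPoincare4.SmoothPoincare4.Theorems.CorkRegluingBudget.stub_weylAdditivity
      C W P jC jW gC gW g hjC hjW hcov hseam' hRC hRW hg hpC hpW) hbudget
  -- the germ `T` in the shape wanted by the transport lemma
  have hTinj : Set.InjOn T U := fun x hx y hy h ↦ by rw [← hTT x hx, ← hTT y hy, h]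
  have hTC : ∀ x ∈ U, x ∈ Set.range jC → T x ∈ Set.range jC := fun x hx h ↦ (hTside x hx).2 h
  have hTW : ∀ x ∈ U, x ∈ Set.range jW → T x ∈ Set.range jW := by
    intro x hx hxW
    by_cases hTx : T x ∈ Set.range jC
    · -- then `x ∈ range jC ∩ range jW` is a seam point
      have hxC : x ∈ Set.range jC := (hTside x hx).1 hTx
      obtain ⟨a, rfl⟩ := hxC
      obtain ⟨b, hb⟩ := hxW
      obtain ⟨z, rfl, -⟩ := (hseam a b).1 hb.symm
      rw [hTτ z, (hseam (bC.incl (τ z)) (bW.incl (φ (τ z)))).2 ⟨τ z, rfl, rfl⟩]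
      exact ⟨_, rfl⟩
    · have hcov' : T x ∈ Set.range jC ∪ Set.range jW := by rw [hcov]; exact Set.mem_univ _
      exact hcov'.resolve_left hTx
  exact Summit.SmoothPoincare4.SmoothPoincare4.Theorems.CorkRegluingBudget.bridge_transportGerm C bC
    W bW φ τ P jC jW g U T hjC hjW hcov hseam hg ⟨hLC, hscal, hWeyl⟩ hU hYU hTs hTinj hTg hTC hTW
    hTτ hS4

/-! **Stub B2 — isometric regluing realises the cork twist** (`stub_isometricRegluing`): LANDED
verbatim (RESHAPE 1, p148994) as
`Summit.SmoothPoincare4.SmoothPoincare4.Theorems.CorkRegluingBudget.stub_isometricRegluing`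
(file `Theorems/WeylBudgetCorkRegluingBudgetStubIsometricRegluing.lean`, with helpers
`…IsometricRegluingTransport` p147256 and `…IsometricRegluingGlue` p147585; Hirsch 1976 Ch. 8 §2,
Bröcker–Jänich 1982 §13, O'Neill 1983 Ch. 3 over the tree's `SmoothGlueData`,
`exists_metric_of_glue_isometry`, `nonempty_diffeomorph_of_isBoundaryGluing_holds`).  The local
sorried copy is removed; the composition below calls the landed theorem. -/

/-- **Assembly of the line** (kernel-checked; no `sorry` of its own — it invokes the three registered stubs BY NAME, the `#h21_check_skeleton` convention; the same proof with the stub statements as hypotheses, `corkRegluingBudget_of_hyps` in the registrar's evidence file `birth_hyps_form.lean`, has axioms propext / Classical.choice / Quot.sound): Stub A presents the homotopy sphere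
`S` as an involutive cork twist `S.carrier = C ∪_{φ∘τ} W` of `S⁴ = C ∪_φ W`; Stub B1 supplies, on
the standard sphere, a Weyl-light PSC metric `g` together with a presentation `jC, jW` and a
side-preserving local `g`-isometry `Φ` near the seam restricting to `τ`; Stub B2 reglues
isometrically into `S.carrier` itself, producing `kC, kW, γ` with `jC^* g = kC^* γ`,
`jW^* g = kW^* γ`.  The remaining two conjuncts of `CorkRegluingBudget` ("pieces meet only along
`∂C`-images", on both sides) follow from the seam relations and `range bC.incl = ∂C`
(`BoundaryData.incl_mem_boundary`).  The conclusion is LITERALLY the route decl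
`Summit.SmoothPoincare4.SmoothPoincare4.Theses.WeylBudget.CorkRegluingBudget`. -/
theorem CorkRegluingBudget_of :
    Summit.SmoothPoincare4.SmoothPoincare4.Theses.WeylBudget.CorkRegluingBudget := by
  intro S
  -- (1) topology: an involutive cork presentation `S⁴ = C ∪_φ W`, `Σ = C ∪_{φ ∘ τ} W`
  obtain ⟨C, tC, t2C, scC, chC, mC, cC, ctrC, bC, W, tW, t2W, scW, chW, mW, cW, bW, φ, τ, hτ,
    hS4, hSig⟩ := stub_involutiveCorkPresentation S
  -- (2) geometry on the STANDARD sphere: a Weyl-light PSC metric `g` with a side-preserving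
  --     local isometry `Φ` near the seam restricting to the cork involution `τ`
  obtain ⟨jC, jW, g, U, Φ, hjC, hjW, hcov, hseam, hg, ⟨hLC, hscal, hweyl⟩, hU, hYU, hΦs, hΦi,
    hΦg, hΦC, hΦW, hΦτ⟩ := stub_symmetricWeylLightMetric C bC W bW φ τ hτ hS4
  -- (3) isometric regluing: the twisted gluing `Σ = S.carrier` is covered by re-embedded
  --     pieces carrying a Riemannian `γ` with the same piece metrics as `g`
  obtain ⟨kC, kW, γ, hkC, hkW, hkcov, hkseam, hγ, hpC, hpW⟩ :=
    Summit.SmoothPoincare4.SmoothPoincare4.Theorems.CorkRegluingBudget.stub_isometricRegluing C bC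
      W bW φ τ jC jW g U Φ hjC hjW hcov hseam hg hU hYU hΦs hΦi hΦg hΦC hΦW hΦτ S.carrier hSig
  -- (4) assemble the seventeen conjuncts of the crux; the two "pieces meet only along
  --     `∂C`-images" clauses follow from the seam relations and `range bC.incl = ∂C`
  refine ⟨C, tC, chC, mC, W, tW, chW, mW, jC, jW, kC, kW, g, γ, cC, ctrC, hjC, hjW, hcov, ?_,
    hkC, hkW, hkcov, ?_, hpC, hpW, hg, hγ, hLC, hscal, hweyl⟩
  · intro c v h
    obtain ⟨z, rfl, -⟩ := (hseam c v).1 h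
    exact bC.incl_mem_boundary z
  · intro c v h
    obtain ⟨z, rfl, -⟩ := (hkseam c v).1 h
    exact bC.incl_mem_boundary z

end Summit.SmoothPoincare4.SmoothPoincare4.Cruxes.CorkRegluingBudget.Birth

end
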